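import Literature.Probability.FitznerVanDerHofstad2017.NbwRemainderFrame
import Literature.Probability.FitznerVanDerHofstad2017.SrwLawBridges
import HarnessLib

/-!
# The frame theorem at a general polynomial majorant, and its PRINTED instance: the trail remainder
# `((a_{c₁} ⋆ ⋯ ⋆ a_{c_n}) ⋆ τ_p^{⋆n})(x)` is bounded by `Γ̄₂ⁿ · (2d)^M K_{n,M}(x)` (b2b-lace, LEMMAS §20 node N68c-P)

Build `lace`, packet node N68c-P (explicit-unit carver).  Companion of `NbwRemainderFrame.lean`
(node N68c-A): there the N53 constants `J_n(∏ Q cᵢ)` were shown to be valid remainder-kernel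
constants (`IsRemKernelConst`) for every polynomial family `Q` realising the non-backtracking counts
`b_m` in `x`-space.  This module observes that the argument uses `b_m` only through TWO facts —
`a_m ≤ b_m` pointwise and `b_m = polyLaw d (Q m)` — and states it once for an ARBITRARY majorant
family `g` with `a_m ≤ g_m = polyLaw d (Q m)` (`isRemKernelConst_of_majorant`, x-uniform kernel, and
`trailRem_le_of_majorant`, the pointwise form keeping the factor `|D̂^{(x)}|`).  The PRINTED chain of
[NoBLE17-I] (5.25) line 2 → line 3 and §5.3.2 (first display, p. 1097) is the instance
`g_m = (2d)^m D^{⋆m}` = the simple-random-walk endpoint counts (`wordLaw`, via the tree identity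
`#{m-step walks 0 → y} = (2d)^m D^{⋆m}(y)` of `SrwLawBridges.lean`), `Q m = X^m`, for which
`J_n(X^M) = (2d)^M K_{n,M}(0)` (`nbwJ_X_pow`): the constants print uses at the remainder reads of the
Stage-1 cells — `(2d)^M K_{n,M}(0)` (= `(2d)^M I_{n,M}(0)` for even `M`), `(2d)^M K_{n,M+1}(0)` at a
unit vector (= `(2d)^M I_{n,M+1}(0)` for odd `M`), and `(2d)^M · T` for any table value `T`
dominating `K_{n,M}` on the endpoint set — are valid `IsRemKernelConst` constants as KERNEL THEOREMS
(`isRemKernelConst_srwK_univ`, `isRemKernelConst_srwK_single`, `isRemKernelConst_srwK_of_le`,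
`isRemKernelConst_srwI_univ`, `isRemKernelConst_srwI_single`, and the `{±eᵢ}` forms
`isRemKernelConst_srwK_unitVecs` / `isRemKernelConst_srwI_unitVecs` via `K_{n,l}(-x) = K_{n,l}(x)`, `srwK_neg`).  Print and the N53 variant are thus ONE
theorem at two polynomial families.  Everything here is a kernel fact about the tree's own objects;
the statements are tagged with the printed display they instantiate and are NOT citable as
literature; no literal of any certificate is produced or consumed here.

CONTEXT (provenance only).  [NoBLE17-I] = R. Fitzner, R. van der Hofstad, *Generalized approach to
the non-backtracking lace expansion*, PTRF 169 (2017) 1041–1119, arXiv:1506.07969, §5.3.1–§5.3.2,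
(5.22)–(5.27); [FvdH17] = R. Fitzner, R. van der Hofstad, *Mean-field behavior for nearest-neighbor
percolation in d > 10*, EJP 22 (2017) no. 43, §4.2 (4.9)–(4.11), (4.18).  USE: the coherence theorem
of the remainder-abstracted Stage-1 oracle (LEMMAS §20 addendum 3 (A), node N68g) consumes exactly
these validity statements slot by slot.
-/

noncomputable section

namespace Literature.Probability.FitznerVanDerHofstad2017

open MeasureTheory Real Finset Filter
open scoped BigOperators
open Literature.Probability.LatticeModels
open Literature.Probability.Percolation
open Literature.Barriers.CriticalPhenomena
open Literature.Barriers.CriticalPhenomena.SpreadOutIsing (delta0 latticeConv convPow latticeConv_comm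
  isZdSymmetric_latticeConv isZdSymmetric_convPow isZdSymmetric_delta0 isZdSymmetric_srwStep
  delta0_nonneg)
open Literature.Barriers.CriticalPhenomena.Slade2006Prop53 (P)

variable {d : ℕ}

/-! ### Trails are walks: `a_m(y) ≤ #{m-step walks 0 → y} = (2d)^m D^{⋆m}(y)` -/

/-- `a_n(x) ≤ #{n-step walks 0 → x}`: a trail is a nearest-neighbour walk.
[cite: FitznerVanDerHofstad2017, §4.2, sentence after (4.18) (EJP p. 35)] -/
theorem card_trailWordsTo_le_count (d n : ℕ) (x : Site d) :
    (trailWordsTo d n x).card ≤ SRW.count d n x := by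
  classical
  unfold SRW.count
  refine Finset.card_le_card fun w hw => ?_
  rw [mem_trailWordsTo] at hw
  simp only [Finset.mem_filter, Finset.mem_univ, true_and]
  rw [← wordPos_eq_endpoint]
  exact hw.2

/-- The simple-random-walk endpoint count `#{m-step walks 0 → y}` as a real function (the law
`(2d)^m D^{⋆m}` of print's remainder step). [cite: FitznerVanDerHofstad2017, §4.2 (4.3) and after (4.18)] -/
def wordLaw (d m : ℕ) (y : Site d) : ℝ := (SRW.count d m y : ℝ)

/-- **`a_m(y) ≤ (2d)^m D^{⋆m}(y)`** in count form: `a_m ≤ #{walks}`.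
[cite: FitznerVanDerHofstad2016NoBLE, (5.25) p. 1097 (line 2 → line 3)] -/
theorem trailLaw_le_wordLaw (m : ℕ) (y : Site d) : trailLaw d m y ≤ wordLaw d m y := by
  unfold trailLaw wordLaw
  exact_mod_cast card_trailWordsTo_le_count d m y

/-- `(∏_{m ∈ c} X^m) = X^{Σ c}`. [folklore] -/
theorem prod_map_X_pow : ∀ c : List ℕ,
    (c.map fun m => (Polynomial.X : Polynomial ℝ) ^ m).prod = Polynomial.X ^ c.sum
  | [] => by simp
  | m :: c => by
    rw [List.map_cons, List.prod_cons, List.sum_cons, pow_add, prod_map_X_pow c]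

/-- `polyLaw d (X^m) = (2d)^m D^{⋆m}`. [cite: FitznerVanDerHofstad2016NoBLE, (3.34) p. 1071] -/
theorem polyLaw_X_pow (m : ℕ) (y : Site d) :
    polyLaw d (Polynomial.X ^ m) y = (2 * (d : ℝ)) ^ m * convPow (srwStep d) m y := by
  unfold polyLaw
  rw [Polynomial.natDegree_X_pow]
  simp_rw [Polynomial.coeff_X_pow]
  simp [Finset.sum_ite_eq', Finset.mem_range]

/-- **`#{m-step walks 0 → y} = polyLaw d (X^m)(y)`**: the SRW counts are realised in `x`-space by the
monomial family. [cite: FitznerVanDerHofstad2017, §4.2 (4.3) (EJP p. 32)] -/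
theorem wordLaw_eq_polyLaw_X_pow (m : ℕ) (y : Site d) :
    wordLaw d m y = polyLaw d (Polynomial.X ^ m) y := by
  rw [wordLaw, polyLaw_X_pow, natCast_count_eq_pow_mul_convPow_srwStep]

/-! ### The frame theorem at a general polynomial majorant family -/

section Majorant

variable (g : ℕ → Site d → ℝ) (Q : ℕ → Polynomial ℝ)

/-- Under `g_m = polyLaw (Q m)`: `g_m` is summable. [folklore] -/
theorem summable_of_polyLaw (hQ : ∀ m (y : Site d), g m y = polyLaw d (Q m) y) (m : ℕ) :
    Summable (g m) := by
  rw [show g m = polyLaw d (Q m) from funext (hQ m)]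
  exact summable_polyLaw _

/-- Under `g_m = polyLaw (Q m)`: `g_m` is `W_d`-invariant. [folklore] -/
theorem isZdSymmetric_of_polyLaw (hQ : ∀ m (y : Site d), g m y = polyLaw d (Q m) y) (m : ℕ) :
    IsZdSymmetric (g m) := by
  rw [show g m = polyLaw d (Q m) from funext (hQ m)]
  exact isZdSymmetric_polyLaw _

/-- Under `g_m = polyLaw (Q m)`: `(g_{c₁} ⋆ ⋯ ⋆ g_{c_n})^(k) = (∏ᵢ Q cᵢ)(2dD̂(k))`.
[cite: HeydenreichVanDerHofstad2017, (1.2.16)–(1.2.17)] -/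
theorem cosFT_pieces_of_polyLaw (hQ : ∀ m (y : Site d), g m y = polyLaw d (Q m) y)
    (hd : 1 ≤ d) (c : List ℕ) (k : Fin d → ℝ) :
    cosFT (pieces g c) k = ((c.map Q).prod).eval (2 * (d : ℝ) * Dhat d k) := by
  rw [cosFT_pieces (summable_of_polyLaw g Q hQ) (isZdSymmetric_of_polyLaw g Q hQ) k c,
    Polynomial.eval_list_prod, List.map_map]
  congr 1
  refine List.map_congr_left fun m _ => ?_
  show cosFT (g m) k = Polynomial.eval (2 * (d : ℝ) * Dhat d k) (Q m)
  rw [show g m = polyLaw d (Q m) from funext (hQ m), cosFT_polyLaw hd]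

/-- Step 1 (x-space) at a majorant: `a_m ≤ g_m` pointwise gives
`Rem_c(p;x) ≤ ((g_{c₁} ⋆ ⋯ ⋆ g_{c_n}) ⋆ τ_p^{⋆n})(x)`. [cite: FitznerVanDerHofstad2016NoBLE, (5.25) p. 1097] -/
theorem trailRem_le_piecesConvTau (hle : ∀ m (y : Site d), trailLaw d m y ≤ g m y)
    (hQ : ∀ m (y : Site d), g m y = polyLaw d (Q m) y)
    (hd : 2 ≤ d) (p : unitInterval) (hp : p < criticalProbI d) (c : List ℕ) (x : Site d) :
    trailRem d p c x ≤ latticeConv (pieces g c) (convPow (tau d p 0) c.length) x := by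
  have hp' : (p : ℝ) < criticalProb (zdGraph d) (0 : Site d) := hp
  have hs : Summable fun x => tau d p 0 x := summable_tau_of_lt_criticalProb hd p hp'
  have hsN := summable_of_polyLaw g Q hQ
  unfold trailRem
  exact latticeConv_mono (summable_pieces hsN c) (summable_convPow_tau hs _)
    (pieces_nonneg trailLaw_nonneg c) (convPow_tau_nonneg p _)
    (pieces_mono trailLaw_nonneg hle hsN c) (fun _ => le_rfl) x

/-- **THE FRAME THEOREM AT A MAJORANT, pointwise form** (keeps `|D̂^{(x)}(k)|`): for every composition
`c` with `2|c|+1 ≤ d`, every majorant family `a_m ≤ g_m = polyLaw (Q m)`, every `p < p_c` and every `x`,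
`Rem_c(p;x) ≤ Γ̄₂(p)ⁿ ∫ |(∏ Q cᵢ)(2dD̂)| |D̂^{(x)}| Ĉⁿ dk/(2π)^d`.
[cite: FitznerVanDerHofstad2016NoBLE, §5.3.2 (first display) p. 1097; (5.25) p. 1097] -/
theorem trailRem_le_of_majorant (hle : ∀ m (y : Site d), trailLaw d m y ≤ g m y)
    (hQ : ∀ m (y : Site d), g m y = polyLaw d (Q m) y)
    (c : List ℕ) (hn : 2 * c.length + 1 ≤ d) (hd : 2 ≤ d)
    (p : unitInterval) (hp : p < criticalProbI d) (x : Site d) :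
    trailRem d p c x ≤ nobleSup2 d p ^ c.length *
      ((∫ k, (|((c.map Q).prod).eval (2 * (d : ℝ) * Dhat d k)| * |DhatSym d x k|)
          * Chat d 1 k ^ c.length ∂P d) / (2 * π) ^ d) := by
  have hd1 : 1 ≤ d := by omega
  have h2 := kernelConvTau_le_nobleSup2_pow_mul_integral hn hd p hp
    (summable_pieces (summable_of_polyLaw g Q hQ) c)
    (isZdSymmetric_pieces (isZdSymmetric_of_polyLaw g Q hQ) c) x
  have h3 : (∫ k, (|cosFT (pieces g c) k| * |DhatSym d x k|) * Chat d 1 k ^ c.length ∂P d)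
      = ∫ k, (|((c.map Q).prod).eval (2 * (d : ℝ) * Dhat d k)| * |DhatSym d x k|)
          * Chat d 1 k ^ c.length ∂P d := by
    refine integral_congr_ae (Eventually.of_forall fun k => ?_)
    simp only [cosFT_pieces_of_polyLaw g Q hQ hd1 c k]
  calc trailRem d p c x
      ≤ latticeConv (pieces g c) (convPow (tau d p 0) c.length) x :=
        trailRem_le_piecesConvTau g Q hle hQ hd p hp c x
    _ ≤ _ := h2
    _ = _ := by rw [h3]

/-- **THE FRAME THEOREM AT A MAJORANT, x-uniform kernel**: for every composition `c` with
`2|c|+1 ≤ d`, every majorant family `a_m ≤ g_m = polyLaw (Q m)`: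
`R = J_n(∏ᵢ Q cᵢ)` is a valid remainder-kernel constant on every endpoint set.  `g = nbwLaw` is
`isRemKernelConst_nbwJ`; `g = wordLaw`, `Q m = X^m` is print (`isRemKernelConst_srwK_univ`).
[cite: FitznerVanDerHofstad2016NoBLE, §5.3.2 (first display) p. 1097; (5.25) p. 1097] -/
theorem isRemKernelConst_of_majorant (hle : ∀ m (y : Site d), trailLaw d m y ≤ g m y)
    (hQ : ∀ m (y : Site d), g m y = polyLaw d (Q m) y)
    (c : List ℕ) (hn : 2 * c.length + 1 ≤ d) (hd : 2 ≤ d) :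
    IsRemKernelConst d c Set.univ (nbwJ d c.length (c.map Q).prod) := by
  intro p hp x _
  have hd1 : 1 ≤ d := by omega
  have h2 := kernelConvTau_le_nobleSup2_pow_mul_integral' hn hd p hp
    (summable_pieces (summable_of_polyLaw g Q hQ) c)
    (isZdSymmetric_pieces (isZdSymmetric_of_polyLaw g Q hQ) c) x
  have h3 : (∫ k, |cosFT (pieces g c) k| * Chat d 1 k ^ c.length ∂P d) / (2 * π) ^ d
      = nbwJ d c.length (c.map Q).prod := by
    unfold nbwJ
    congr 1
    refine integral_congr_ae (Eventually.of_forall fun k => ?_)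
    simp only [cosFT_pieces_of_polyLaw g Q hQ hd1 c k]
  calc trailRem d p c x
      ≤ latticeConv (pieces g c) (convPow (tau d p 0) c.length) x :=
        trailRem_le_piecesConvTau g Q hle hQ hd p hp c x
    _ ≤ nobleSup2 d p ^ c.length *
          ((∫ k, |cosFT (pieces g c) k| * Chat d 1 k ^ c.length ∂P d) / (2 * π) ^ d) := h2
    _ = nobleSup2 d p ^ c.length * nbwJ d c.length (c.map Q).prod := by rw [h3]

end Majorant

/-! ### The printed constants: `g_m = #{m-step walks} = (2d)^m D^{⋆m}`, `Q m = X^m` -/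

/-- **PRINT, pointwise — [NoBLE17-I] (5.25) line 2 → 3 with §5.3.2 (first display)**: for every
composition `c` (`n = |c|` pieces, total order `M = Σ c`) with `2n+1 ≤ d`, every `p < p_c` and EVERY `x`,
`Rem_c(p;x) ≤ Γ̄₂(p)ⁿ · (2d)^M K_{n,M}(x)`.
[cite: FitznerVanDerHofstad2016NoBLE, (5.25) p. 1097 and §5.3.2 (first display) p. 1097]
[cite: FitznerVanDerHofstad2017, §4.2 (4.9)–(4.11) (EJP pp. 33–34)] -/
theorem trailRem_le_pow_mul_srwK (c : List ℕ) (hn : 2 * c.length + 1 ≤ d) (hd : 2 ≤ d)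
    (p : unitInterval) (hp : p < criticalProbI d) (x : Site d) :
    trailRem d p c x ≤ nobleSup2 d p ^ c.length * ((2 * (d : ℝ)) ^ c.sum * srwK d c.length c.sum x) := by
  have h := trailRem_le_of_majorant (wordLaw d) (fun m => Polynomial.X ^ m) trailLaw_le_wordLaw
    wordLaw_eq_polyLaw_X_pow c hn hd p hp x
  have hint : (∫ k, (|((c.map fun m => (Polynomial.X : Polynomial ℝ) ^ m).prod).eval
        (2 * (d : ℝ) * Dhat d k)| * |DhatSym d x k|) * Chat d 1 k ^ c.length ∂P d) / (2 * π) ^ d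
      = (2 * (d : ℝ)) ^ c.sum * srwK d c.length c.sum x := by
    rw [srwK, ← mul_div_assoc, ← integral_const_mul]
    congr 1
    refine integral_congr_ae (ae_of_all _ fun k => ?_)
    have h2d : |2 * (d : ℝ) * Dhat d k| ^ c.sum = (2 * (d : ℝ)) ^ c.sum * |Dhat d k| ^ c.sum := by
      rw [abs_mul, mul_pow, abs_of_nonneg (by positivity : (0 : ℝ) ≤ 2 * (d : ℝ))]
    show (|((c.map fun m => (Polynomial.X : Polynomial ℝ) ^ m).prod).eval (2 * (d : ℝ) * Dhat d k)|
        * |DhatSym d x k|) * Chat d 1 k ^ c.length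
      = (2 * (d : ℝ)) ^ c.sum * ((|Dhat d k| ^ c.sum * |DhatSym d x k|) * Chat d 1 k ^ c.length)
    rw [prod_map_X_pow, Polynomial.eval_pow, Polynomial.eval_X, abs_pow, h2d]
    ring
  rw [hint] at h
  exact h

/-- **PRINT, x-uniform — the constant of the Stage-1 cells 8 and 11**: `R = (2d)^M K_{n,M}(0)` is a
valid remainder-kernel constant for every composition of `M` into `n` pieces, on every endpoint set
(`J_n(X^M) = (2d)^M K_{n,M}(0)`, `nbwJ_X_pow`).
[cite: FitznerVanDerHofstad2016NoBLE, §5.3.2 (first display) p. 1097; (5.25)–(5.27) pp. 1097–1098] -/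
theorem isRemKernelConst_srwK_univ (c : List ℕ) (hn : 2 * c.length + 1 ≤ d) (hd : 2 ≤ d) :
    IsRemKernelConst d c Set.univ ((2 * (d : ℝ)) ^ c.sum * srwK d c.length c.sum 0) := by
  have h := isRemKernelConst_of_majorant (wordLaw d) (fun m => Polynomial.X ^ m) trailLaw_le_wordLaw
    wordLaw_eq_polyLaw_X_pow c hn hd
  rwa [prod_map_X_pow, nbwJ_X_pow] at h

/-- **PRINT, table form — the constant of the Stage-1 cell 12** (`K[n,M,{1}]` read as a value `T`
dominating `K_{n,M}(x)` on the endpoint set `X`, e.g. `X = {x ≠ 0}`): `R = (2d)^M · T` is valid on `X`.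
[cite: FitznerVanDerHofstad2016NoBLE, §5.3.2 (first display) p. 1097; (3.36) p. 1071] -/
theorem isRemKernelConst_srwK_of_le (c : List ℕ) (hn : 2 * c.length + 1 ≤ d) (hd : 2 ≤ d)
    {X : Set (Site d)} {T : ℝ} (hT : ∀ x ∈ X, srwK d c.length c.sum x ≤ T) :
    IsRemKernelConst d c X ((2 * (d : ℝ)) ^ c.sum * T) := by
  intro p hp x hx
  refine (trailRem_le_pow_mul_srwK c hn hd p hp x).trans (mul_le_mul_of_nonneg_left
    (mul_le_mul_of_nonneg_left (hT x hx) (pow_nonneg (by positivity) _))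
    (pow_nonneg (nobleSup2_nonneg' p) _))

/-- **PRINT at the unit vectors — the constant of the Stage-1 cell 5** (`K_{n,M}(eᵢ) = K_{n,M+1}(0)`,
`srwK_single`): `R = (2d)^M K_{n,M+1}(0)` is valid on `{eᵢ}`.
[cite: FitznerVanDerHofstad2016NoBLE, §5.3.2 (first display) p. 1097; (3.34)–(3.36) p. 1071] -/
theorem isRemKernelConst_srwK_single (c : List ℕ) (hn : 2 * c.length + 1 ≤ d) (hd : 2 ≤ d) :
    IsRemKernelConst d c (Set.range fun i : Fin d => (Pi.single i (1 : ℤ) : Site d))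
      ((2 * (d : ℝ)) ^ c.sum * srwK d c.length (c.sum + 1) 0) := by
  refine isRemKernelConst_srwK_of_le c hn hd fun x hx => ?_
  obtain ⟨i, rfl⟩ := hx
  rw [srwK_single]

/-- `D̂^{(-x)}(k) = D̂^{(x)}(k)`: the symmetrised mode is even in `x` (cosine is even).
[cite: FitznerVanDerHofstad2016NoBLE, (3.34) p. 1071] -/
theorem DhatSym_neg (x : Site d) (k : Fin d → ℝ) : DhatSym d (-x) k = DhatSym d x k := by
  rw [DhatSym_def, DhatSym_def]
  congr 1
  refine Finset.sum_congr rfl fun ν _ => Finset.sum_congr rfl fun δ _ => ?_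
  rw [← Real.cos_neg, ← Finset.sum_neg_distrib]
  congr 1
  refine Finset.sum_congr rfl fun j _ => ?_
  simp only [Pi.neg_apply, Int.cast_neg]
  ring

/-- `K_{n,l}(-x) = K_{n,l}(x)`. [cite: FitznerVanDerHofstad2016NoBLE, (3.36) p. 1071] -/
theorem srwK_neg (n l : ℕ) (x : Site d) : srwK d n l (-x) = srwK d n l x := by
  unfold srwK
  simp_rw [DhatSym_neg]

/-- **PRINT at the signed unit vectors `{±eᵢ}`** (the endpoint set of the Stage-1 cell-5 read,
two-point function at a neighbour of the origin): `R = (2d)^M K_{n,M+1}(0)` is valid on `{±eᵢ}`.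
[cite: FitznerVanDerHofstad2016NoBLE, §5.3.2 (first display) p. 1097; (3.34)–(3.36) p. 1071] -/
theorem isRemKernelConst_srwK_unitVecs (c : List ℕ) (hn : 2 * c.length + 1 ≤ d) (hd : 2 ≤ d) :
    IsRemKernelConst d c
      {x | ∃ i : Fin d, x = Pi.single i (1 : ℤ) ∨ x = -Pi.single i (1 : ℤ)}
      ((2 * (d : ℝ)) ^ c.sum * srwK d c.length (c.sum + 1) 0) := by
  refine isRemKernelConst_srwK_of_le c hn hd fun x hx => ?_
  obtain ⟨i, rfl | rfl⟩ := hx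
  · rw [srwK_single]
  · rw [srwK_neg, srwK_single]

/-- **PRINT, even total order** (the notebook's `Ivalue[n,R′,{0}]`, `R′` even): `R = (2d)^M I_{n,M}(0)`
is valid on every endpoint set (`K_{n,2j}(0) = I_{n,2j}(0)`, [NoBLE17-I] (5.14)).
[cite: FitznerVanDerHofstad2016NoBLE, (5.14) p. 1092; §5.3.2 (first display) p. 1097] -/
theorem isRemKernelConst_srwI_univ (c : List ℕ) (hn : 2 * c.length + 1 ≤ d) (hd : 2 ≤ d)
    {j : ℕ} (hc : c.sum = 2 * j) :
    IsRemKernelConst d c Set.univ ((2 * (d : ℝ)) ^ c.sum * srwI d c.length c.sum 0) := by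
  have h := isRemKernelConst_srwK_univ c hn hd
  rwa [hc, srwK_zero_even, ← hc] at h

/-- **PRINT at the unit vectors, odd total order** (the notebook's cell-5 read `Ivalue[1,R′,{0}]` for the
composition `[R′-1]`, `R′` even): `R = (2d)^M I_{n,M+1}(0)` is valid on `{eᵢ}`
(`K_{n,2j+1}(eᵢ) = I_{n,2j+2}(0)`). [cite: FitznerVanDerHofstad2016NoBLE, (3.34)–(3.36) p. 1071, (5.14) p. 1092] -/
theorem isRemKernelConst_srwI_single (c : List ℕ) (hn : 2 * c.length + 1 ≤ d) (hd : 2 ≤ d)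
    {j : ℕ} (hc : c.sum = 2 * j + 1) :
    IsRemKernelConst d c (Set.range fun i : Fin d => (Pi.single i (1 : ℤ) : Site d))
      ((2 * (d : ℝ)) ^ c.sum * srwI d c.length (c.sum + 1) 0) := by
  have h := isRemKernelConst_srwK_single c hn hd
  rwa [hc, show 2 * j + 1 + 1 = 2 * (j + 1) by ring, srwK_zero_even,
    show 2 * (j + 1) = 2 * j + 1 + 1 by ring, ← hc] at h

/-- **PRINT at `{±eᵢ}`, odd total order**: `R = (2d)^M I_{n,M+1}(0)` is valid on `{±eᵢ}`.
[cite: FitznerVanDerHofstad2016NoBLE, (3.34)–(3.36) p. 1071, (5.14) p. 1092] -/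
theorem isRemKernelConst_srwI_unitVecs (c : List ℕ) (hn : 2 * c.length + 1 ≤ d) (hd : 2 ≤ d)
    {j : ℕ} (hc : c.sum = 2 * j + 1) :
    IsRemKernelConst d c
      {x | ∃ i : Fin d, x = Pi.single i (1 : ℤ) ∨ x = -Pi.single i (1 : ℤ)}
      ((2 * (d : ℝ)) ^ c.sum * srwI d c.length (c.sum + 1) 0) := by
  have h := isRemKernelConst_srwK_unitVecs c hn hd
  rwa [hc, show 2 * j + 1 + 1 = 2 * (j + 1) by ring, srwK_zero_even,
    show 2 * (j + 1) = 2 * j + 1 + 1 by ring, ← hc] at h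

/-- **The licence for `min(printed read, N53 read)` at an x-uniform slot**: both constants are valid,
hence so is their minimum (`IsRemKernelConst.min`). [cite: FitznerVanDerHofstad2016NoBLE, §5.3.2 (first display) p. 1097] -/
theorem isRemKernelConst_min_srwK_nbwJ (Q : ℕ → Polynomial ℝ) (c : List ℕ)
    (hn : 2 * c.length + 1 ≤ d) (hd : 2 ≤ d)
    (hQ : ∀ m (y : Site d), nbwLaw d m y = polyLaw d (Q m) y) :
    IsRemKernelConst d c Set.univ
      (min ((2 * (d : ℝ)) ^ c.sum * srwK d c.length c.sum 0) (nbwJ d c.length (c.map Q).prod)) :=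
  (isRemKernelConst_srwK_univ c hn hd).min (isRemKernelConst_nbwJ Q c hn hd hQ)



end Literature.Probability.FitznerVanDerHofstad2017

end
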